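import Mathlib
import Summits.KontsevichZagierPeriods.Zeta5Search.Families.BasicGrowthSymmetry
import HarnessLib

/-!
# ζ(5) search — Families: symmetries of the growth constant — a turnkey API (`M_τ = M_σ` from a dihedral witness)

HONEST FRAMING: systematic search; no irrationality claim unless certified.  STRUCTURAL (size of cellular integrals);
nothing about the arithmetic of any zeta value.  Seat P2, Families layer.

`Families/BasicGrowthSymmetry.lean` proved that `M_σ = fSup σ` is invariant under the four generators of the dihedral
relabellings of positions and labels.  This file packages them for designers: general position shifts / reversals
(`fSup_shift_const`, `fSup_reverse_const`), `reflIdx` is an involution (`reflIdx_reflIdx`, `reflIdx_bijective`), the four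
combined forms `fSup_dihedral_shift` / `_reverse` / `_reflect_shift` / `_reflect_reverse`
(`M_{D ∘ σ ∘ A + k·1} = M_σ` for `A = (c + ·)` or `(c − ·)`, `D = id` or `reflIdx`), and the master statement
**`fSup_eq_of_dihedral`**: if `τ i = D (σ (A i)) + k • 1` for all `i` (a hypothesis `decide` settles for concrete seatings)
then `fSup τ = fSup σ`.  So a certified constant for one representative of a census class
(`Families/Atlas8Growth.lean`, `Families/CellularEightGrowthConstants*.lean`) transfers to every seating of the class by
exhibiting `(c, k, flags)`.  Standard axioms only.
-/

noncomputable section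

open Finset

namespace Summit.KontsevichZagierPeriods.Zeta5Search.Families.Cellular

variable {ℓ : ℕ} (σ : Fin (ℓ + 3) → Fin (ℓ + 3))

/-! ### `reflIdx` is an involution -/

/-- `reflIdx (reflIdx u) = u`. -/
theorem reflIdx_reflIdx (u : Fin (ℓ + 3)) : reflIdx (reflIdx u) = u := by
  by_cases hu : u.val = ℓ + 2
  · rw [reflIdx_of_eq hu, reflIdx_of_eq hu]
  · have h1 := reflIdx_val_of_ne hu
    have h2 : (reflIdx u).val ≠ ℓ + 2 := by rw [h1]; omega
    apply Fin.ext
    rw [reflIdx_val_of_ne h2, h1]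
    have := u.isLt
    omega

/-- `reflIdx` is a bijection of the labels. -/
theorem reflIdx_bijective : Function.Bijective (reflIdx : Fin (ℓ + 3) → Fin (ℓ + 3)) :=
  Function.Involutive.bijective reflIdx_reflIdx

/-! ### General position shifts and reversals -/

/-- `f_{σ(c + ·)} = f_σ` pointwise. -/
theorem fSigma_shift_const (c : Fin (ℓ + 3)) (t : Fin ℓ → ℝ) : fSigma (fun i => σ (c + i)) t = fSigma σ t := by
  unfold fSigma formDen
  congr 1
  refine Fintype.prod_equiv (Equiv.addLeft c) _ _ fun i => ?_
  show ef t (σ (c + i)) (σ (c + (i + 1))) = ef t (σ (c + i)) (σ (c + i + 1))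
  rw [add_assoc]

/-- `f_{σ(c − ·)} = f_σ` pointwise. -/
theorem fSigma_reverse_const (c : Fin (ℓ + 3)) (t : Fin ℓ → ℝ) : fSigma (fun i => σ (c - i)) t = fSigma σ t := by
  unfold fSigma formDen
  congr 1
  refine Fintype.prod_equiv ((Equiv.addRight (1 : Fin (ℓ + 3))).trans (Equiv.subLeft c)) _ _ fun i => ?_
  show ef t (σ (c - i)) (σ (c - (i + 1))) = ef t (σ (c - (i + 1))) (σ (c - (i + 1) + 1))
  rw [show c - (i + 1) + 1 = c - i by abel, ef_comm]

/-- `M_{σ(c + ·)} = M_σ`. -/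
theorem fSup_shift_const (c : Fin (ℓ + 3)) : fSup (fun i => σ (c + i)) = fSup σ := by
  have h : fSigma (fun i => σ (c + i)) = fSigma σ := funext (fSigma_shift_const σ c)
  simp only [fSup, h]

/-- `M_{σ(c − ·)} = M_σ`. -/
theorem fSup_reverse_const (c : Fin (ℓ + 3)) : fSup (fun i => σ (c - i)) = fSup σ := by
  have h : fSigma (fun i => σ (c - i)) = fSigma σ := funext (fSigma_reverse_const σ c)
  simp only [fSup, h]

/-! ### The four combined forms -/

variable {σ}

/-- `M_{σ(c + ·) + k·1} = M_σ` (bijective `σ`). -/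
theorem fSup_dihedral_shift (hσ : Function.Bijective σ) (c : Fin (ℓ + 3)) (k : ℕ) :
    fSup (fun i => σ (c + i) + k • (1 : Fin (ℓ + 3))) = fSup σ := by
  have hb : Function.Bijective fun i => σ (c + i) := hσ.comp (Equiv.addLeft c).bijective
  rw [fSup_add_nsmul _ hb, fSup_shift_const]

/-- `M_{σ(c − ·) + k·1} = M_σ` (bijective `σ`). -/
theorem fSup_dihedral_reverse (hσ : Function.Bijective σ) (c : Fin (ℓ + 3)) (k : ℕ) :
    fSup (fun i => σ (c - i) + k • (1 : Fin (ℓ + 3))) = fSup σ := by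
  have hb : Function.Bijective fun i => σ (c - i) := hσ.comp (Equiv.subLeft c).bijective
  rw [fSup_add_nsmul _ hb, fSup_reverse_const]

/-- `M_{reflIdx ∘ σ(c + ·) + k·1} = M_σ` (bijective `σ`). -/
theorem fSup_dihedral_reflect_shift (hσ : Function.Bijective σ) (c : Fin (ℓ + 3)) (k : ℕ) :
    fSup (fun i => reflIdx (σ (c + i)) + k • (1 : Fin (ℓ + 3))) = fSup σ := by
  have hb : Function.Bijective fun i => reflIdx (σ (c + i)) :=
    reflIdx_bijective.comp (hσ.comp (Equiv.addLeft c).bijective)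
  rw [fSup_add_nsmul _ hb, fSup_reflect (fun i => σ (c + i)), fSup_shift_const]

/-- `M_{reflIdx ∘ σ(c − ·) + k·1} = M_σ` (bijective `σ`). -/
theorem fSup_dihedral_reflect_reverse (hσ : Function.Bijective σ) (c : Fin (ℓ + 3)) (k : ℕ) :
    fSup (fun i => reflIdx (σ (c - i)) + k • (1 : Fin (ℓ + 3))) = fSup σ := by
  have hb : Function.Bijective fun i => reflIdx (σ (c - i)) :=
    reflIdx_bijective.comp (hσ.comp (Equiv.subLeft c).bijective)
  rw [fSup_add_nsmul _ hb, fSup_reflect (fun i => σ (c - i)), fSup_reverse_const]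

/-! ### Master statement: a dihedral witness transfers the growth constant -/

/-- The relabelled seating described by a dihedral witness `(c, k, rev, refl)`: position `i ↦ c ± i`, then `σ`, then
optionally the label reflection, then the label rotation by `k`. -/
def dihedralImage (σ : Fin (ℓ + 3) → Fin (ℓ + 3)) (c : Fin (ℓ + 3)) (k : ℕ) (rev refl : Bool) (i : Fin (ℓ + 3)) :
    Fin (ℓ + 3) :=
  (if refl then reflIdx (σ (if rev then c - i else c + i)) else σ (if rev then c - i else c + i)) +
    k • (1 : Fin (ℓ + 3))

/-- **`M_τ = M_σ` from a dihedral witness.**  If `τ = dihedralImage σ c k rev refl` pointwise (for concrete seatings: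
`by decide`) and `σ` is bijective, then `fSup τ = fSup σ`. -/
theorem fSup_eq_of_dihedral (hσ : Function.Bijective σ) {τ : Fin (ℓ + 3) → Fin (ℓ + 3)} (c : Fin (ℓ + 3)) (k : ℕ)
    (rev refl : Bool) (h : ∀ i, τ i = dihedralImage σ c k rev refl i) : fSup τ = fSup σ := by
  have hτ : τ = dihedralImage σ c k rev refl := funext h
  subst hτ
  unfold dihedralImage
  cases rev <;> cases refl
  · simpa using fSup_dihedral_shift hσ c k
  · simpa using fSup_dihedral_reflect_shift hσ c k
  · simpa using fSup_dihedral_reverse hσ c k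
  · simpa using fSup_dihedral_reflect_reverse hσ c k

/-- Usage (kernel): for the six-point seating `σ = (5,1,3,0,2,4)` (0-based; `5 = ∞`) and the witness
`(c, k, rev, refl) = (2, 1, true, true)`, the relabelled seating `(2,4,0,1,3,5)` has the same growth constant — both
hypotheses by `decide`. -/
example : fSup (![2, 4, 0, 1, 3, 5] : Fin 6 → Fin 6) = fSup (![5, 1, 3, 0, 2, 4] : Fin 6 → Fin 6) :=
  fSup_eq_of_dihedral (σ := (![5, 1, 3, 0, 2, 4] : Fin (3 + 3) → Fin (3 + 3))) (by decide) 2 1 true true (by decide)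

end Summit.KontsevichZagierPeriods.Zeta5Search.Families.Cellular
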